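import Summits.PneNP.PneNP.Theses.EcdlpDefinability
import Summits.PneNP.PneNP.Theorems.EcdlpDefinabilityEcdlpInNP
import Literature.Computability.Cryptography.EcdlpLanguage
import Literature.Computability.Complexity.ClayProblem
import Literature.Computability.Complexity.TimeSpaceChainProofs
import Literature.Computability.Complexity.Space
import Literature.Computability.Complexity.ConstantDepth

/-!
# BC2(c) probes, part A — restricted-model pieces, the simulation piece, the seam, converses

Census companion (crux `EcdlpNotInP` = X, stmt-PneNP-2071; S = `PneNP`; prose: `STRATEGY-CENSUS.md`; obstruction
lemmas: `StrategyCensus.lean`). Each `example` runs the prescribed cheap probe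
`first | exact? | simpa [C] | (unfold C; simpa) | aesop` at 400000 heartbeats; every chain ends in `| sorry`, so a
FAILED probe elaborates as one `sorry` and a SUCCESSFUL probe leaves none (the sorry count of `lean check` = number of
failed probes). Self-contained: the section `Local` re-declares VERBATIM the four census lemmas the by-name probes need
(`StrategyCensus.mp_seam`, `…not_mem_LOGSPACE_of_ecdlpNotInP`, `…not_mem_DTIME_of_ecdlpNotInP`, `…pneNP_of_ecdlpNotInP`),
so that this file elaborates independently of the build state of the census module.

Pieces: W_L := `L_EC ∉ LOGSPACE`, W_T := `L_EC ∉ DTIME(n²)`, W_NC := `L_EC ∉ NC¹` (non-uniform),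
W_Def := `DefinableLogBound` (route crux 2073), W_En := `IntervalPointSetEnergy` (route crux 2074),
B_L := `L_EC ∈ P → L_EC ∈ LOGSPACE` (simulation piece).
EXPECTED: sorries at A1–A12 and A14 (13 failed probes); no sorry at A13 (the whole W_L ∧ B_L assembly — trivial seam),
A15–A17 (W_L, W_T are CONSEQUENCES of X by name; X → S by name = the RESTATED signal).
-/

set_option linter.dupNamespace false
set_option linter.unusedVariables false
set_option linter.unusedTactic false
set_option linter.unreachableTactic false

namespace Summit.PneNP.PneNP.Cruxes.EcdlpNotInP.ProbesA

open Literature.Computability.Complexity Literature.Computability.Cryptography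
open Summit.PneNP.PneNP.Theses.EcdlpDefinability

namespace Local

/-- = `StrategyCensus.pneNP_of_ecdlpNotInP` (X ≥ S by name). [cite: CookClay2006, §1] -/
theorem pneNP_of_ecdlpNotInP (hX : EcdlpNotInP) : _root_.PneNP :=
  closes Summit.PneNP.PneNP.Theorems.ecdlpDefinability_ecdlpInNP_proof hX

/-- = `StrategyCensus.mp_seam` (the one-line seam). [folklore] -/
theorem mp_seam (𝓜 : Set (Language Bool)) (hW : EcdlpLanguage ∉ 𝓜)
    (hB : EcdlpLanguage ∈ PNPWave0.P Bool → EcdlpLanguage ∈ 𝓜) : EcdlpNotInP :=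
  fun hP => hW (hB hP)

/-- = `StrategyCensus.not_mem_LOGSPACE_of_ecdlpNotInP`. [cite: AroraBarak2009, §4.1] -/
theorem not_mem_LOGSPACE_of_ecdlpNotInP (hX : EcdlpNotInP) : EcdlpLanguage ∉ LOGSPACE := by
  change EcdlpLanguage ∉ PNPWave0.P Bool at hX
  rw [show PNPWave0.P Bool = Classes.P from P_bool_eq_holds] at hX
  exact fun hL => hX (LOGSPACE_subset_P_holds hL)

/-- = `StrategyCensus.not_mem_DTIME_of_ecdlpNotInP`. [cite: AroraBarak2009, Def. 1.13] -/
theorem not_mem_DTIME_of_ecdlpNotInP (hX : EcdlpNotInP) (k : ℕ) : EcdlpLanguage ∉ DTIME (fun n => n ^ k) := by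
  change EcdlpLanguage ∉ PNPWave0.P Bool at hX
  rw [show PNPWave0.P Bool = Classes.P from P_bool_eq_holds] at hX
  exact fun hk => hX (Set.mem_iUnion.2 ⟨k, hk⟩)

end Local

open Local

/-- W_L -/ def W_L : Prop := EcdlpLanguage ∉ LOGSPACE
/-- W_T -/ def W_T : Prop := EcdlpLanguage ∉ DTIME (fun n => n ^ 2)
/-- W_NC -/ def W_NC : Prop := EcdlpLanguage ∉ NC1
/-- W_Def -/ def W_Def : Prop := DefinableLogBound
/-- W_En -/ def W_En : Prop := IntervalPointSetEnergy
/-- B_L -/ def B_L : Prop := EcdlpLanguage ∈ PNPWave0.P Bool → EcdlpLanguage ∈ LOGSPACE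

-- A1  W_L → S
set_option maxHeartbeats 400000 in
example : W_L → _root_.PneNP := by
  first | exact? | simpa [W_L] | (unfold W_L; simpa) | (aesop (config := { terminal := true })) | sorry
-- A2  W_L → X
set_option maxHeartbeats 400000 in
example : W_L → EcdlpNotInP := by
  first | exact? | simpa [W_L] | (unfold W_L; simpa) | (aesop (config := { terminal := true })) | sorry
-- A3  W_T → S
set_option maxHeartbeats 400000 in
example : W_T → _root_.PneNP := by
  first | exact? | simpa [W_T] | (unfold W_T; simpa) | (aesop (config := { terminal := true })) | sorry
-- A4  W_T → X
set_option maxHeartbeats 400000 in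
example : W_T → EcdlpNotInP := by
  first | exact? | simpa [W_T] | (unfold W_T; simpa) | (aesop (config := { terminal := true })) | sorry
-- A5  W_NC → S
set_option maxHeartbeats 400000 in
example : W_NC → _root_.PneNP := by
  first | exact? | simpa [W_NC] | (unfold W_NC; simpa) | (aesop (config := { terminal := true })) | sorry
-- A6  W_NC → X
set_option maxHeartbeats 400000 in
example : W_NC → EcdlpNotInP := by
  first | exact? | simpa [W_NC] | (unfold W_NC; simpa) | (aesop (config := { terminal := true })) | sorry
-- A7  W_Def → S
set_option maxHeartbeats 400000 in
example : W_Def → _root_.PneNP := by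
  first | exact? | simpa [W_Def] | (unfold W_Def; simpa) | (aesop (config := { terminal := true })) | sorry
-- A8  W_Def → X
set_option maxHeartbeats 400000 in
example : W_Def → EcdlpNotInP := by
  first | exact? | simpa [W_Def] | (unfold W_Def; simpa) | (aesop (config := { terminal := true })) | sorry
-- A9  W_En → S
set_option maxHeartbeats 400000 in
example : W_En → _root_.PneNP := by
  first | exact? | simpa [W_En] | (unfold W_En; simpa) | (aesop (config := { terminal := true })) | sorry
-- A10 W_En → X
set_option maxHeartbeats 400000 in
example : W_En → EcdlpNotInP := by
  first | exact? | simpa [W_En] | (unfold W_En; simpa) | (aesop (config := { terminal := true })) | sorry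
-- A11 B_L → S
set_option maxHeartbeats 400000 in
example : B_L → _root_.PneNP := by
  first | exact? | simpa [B_L] | (unfold B_L; simpa) | (aesop (config := { terminal := true })) | sorry
-- A12 B_L → X
set_option maxHeartbeats 400000 in
example : B_L → EcdlpNotInP := by
  first | exact? | simpa [B_L] | (unfold B_L; simpa) | (aesop (config := { terminal := true })) | sorry
-- A13 the WHOLE assembly W_L → B_L → X (trivial seam; expected to be found)
set_option maxHeartbeats 400000 in
example : W_L → B_L → EcdlpNotInP := by
  first | exact? | (unfold W_L B_L; intro hW hB; exact mp_seam _ hW hB) | (aesop (config := { terminal := true })) | sorry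
/-- A13' the seam quoted as a term: ONE line, no lemma needed. [folklore] -/
theorem seam_quoted : W_L → B_L → EcdlpNotInP := fun hW hB hP => hW (hB hP)
-- A14 converse S → X (S is existential; must fail)
set_option maxHeartbeats 400000 in
example : _root_.PneNP → EcdlpNotInP := by
  first | exact? | simpa | (aesop (config := { terminal := true })) | sorry
-- A15 converse X → W_L (W_L is a consequence of X, by name)
set_option maxHeartbeats 400000 in
example : EcdlpNotInP → W_L := by
  first | exact? | simpa [W_L] | (unfold W_L; exact?) | (aesop (config := { terminal := true })) | sorry
-- A16 converse X → W_T (W_T is a consequence of X, by name)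
set_option maxHeartbeats 400000 in
example : EcdlpNotInP → W_T := by
  first | exact? | simpa [W_T] | (unfold W_T; exact fun h => not_mem_DTIME_of_ecdlpNotInP h 2) | (aesop (config := { terminal := true })) | sorry
-- A17 X → S (the RESTATED signal, by name)
set_option maxHeartbeats 400000 in
example : EcdlpNotInP → _root_.PneNP := by
  first | exact? | simpa | (aesop (config := { terminal := true })) | sorry

end Summit.PneNP.PneNP.Cruxes.EcdlpNotInP.ProbesA
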